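import Summits.ResolutionOfSingularities.ResolutionOfSingularities.Theorems.EquisingularLiftEquisingularLiftNatFirstOrderPoints
import HarnessLib

/-!
# [OURS] SECOND-ORDER (TWO-STEP) POINTS, polynomial currency: after ONE blow-up of a surface point with tangent cone `y₀y₁` the strict
# transform is regular along the exceptional divisor except possibly at ONE point (the origin of the `y₂`-chart); the `A₃` specimen
# `y₀y₁ + y₂⁴` is NOT first-order and its exceptional singular point is a node (first-order in every characteristic) — a LEVEL-1 certificate
# (cruxes `Theses.EquisingularLift.EquisingularLiftNat` / `…NatThree` / `EquisingularLift`, stmt-ResolutionOfSingularities-20038 / -20148 / -15660)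

[OURS · leafhand-res-equisingularlift-11 g0, 2026-08-31; cell `pub/decomp-res`] AI-produced, weaker than expert review; NOT a statement of any manuscript;
nothing here proves resolution of singularities in positive characteristic.  DEF-FREE helper; no `sorry`; standard axioms; ZERO named hypotheses.

Currency of ✓ `FirstOrderPoint.exists_strictTransform` (…NatFirstOrderStrictTransform): a vertex chart `f ∈ K[y]`, the chart-`l` substitution
`y_j ↦ T_l·T_j (j ≠ l)`, `y_l ↦ T_l`, the strict transform `G_l` with `f(T_l, T_lT_j) = T_l^μ·G_l`, and the Jacobian test at the primes `P ∋ T_l, G_l`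
(the points of the strict transform on the exceptional divisor `E = V(T_l)` of chart `l`).  The FIRST-ORDER points (level `0` of the depth programme of
leafhand-10: ✓ `towerLevel_zero_of_model`) are those where the test passes at EVERY such prime.  The next rung (level `1`, ✓ `towerLevel_succ_of_model`:
«regular over the point off finitely many closed points of level `0`») needs, on the polynomial side, (i) a proof that the singular points of the
`G_l` on `E` are FINITELY many explicit closed points and (ii) a first-order certificate at each.  This file supplies both for the tangent cone
`Φ = y₀y₁` in `K[y₀, y₁, y₂]` (the `A_k`, `k ≥ 2`, surface points; every field, every characteristic):

* `SecondOrderPoint.pderiv_not_mem_of_sub_X_mem_span` — GRAPH CHARTS: if `G ≡ T_j (mod T_l)`, `j ≠ l`, then `∂_jG ∉ P` at every prime `P ∋ T_l`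
  (`∂_jG ≡ 1 (mod T_l)`): the strict transform is regular along `E` in chart `l`;
* `SecondOrderPoint.X_mem_of_sub_mul_mem_span` — PRODUCT CHART: if `G ≡ T_a·T_b (mod T_l)` (`a, b, l` pairwise distinct) then a prime `P ∋ T_l`
  containing `∂_aG` and `∂_bG` contains `T_a` and `T_b`; in `K[y₀, y₁, y₂]` (`SecondOrderPoint.forall_X_mem_of_sub_mul_mem_span₃`) such a prime contains
  ALL the variables — the only possibly singular point of the strict transform on `E` is the origin of the chart;
* ★ `SecondOrderPoint.strictTransform_A_chart₀ / ₁ / ₂` — for `f = y₀y₁ + Ψ`, `Ψ ∈ (y)³` ARBITRARY: explicit strict transforms `G₀ = T₁ + T₀·R`,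
  `G₁ = T₀ + T₁·R`, `G₂ = T₀T₁ + T₂·R` with the total-transform identities `f(T_l, T_lT_j) = T_l²·G_l`;
* ★★ `SecondOrderPoint.A_charts_regular_off_origin₂` — CONSEQUENCE: for such `f`, in charts `0` and `1` the Jacobian test passes at every prime of `E`,
  and in chart `2` it can fail only at primes containing `T₀, T₁, T₂` (the origin of chart `2`);
* ★★ THE `A₃` SPECIMEN `f = y₀y₁ + y₂⁴` (every characteristic): `SecondOrderPoint.A₃_strictTransform₂` (`G₂ = T₀T₁ + T₂²` on the nose),
  `SecondOrderPoint.A₃_not_firstOrder` (`b = e₂` is a common non-zero zero of `Φ = y₀y₁`, `∇Φ`, `Ψ₁ = 0`: (FO) FAILS, the point is NOT one-step by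
  ✓ `FirstOrderPoint.firstOrder_iff_oneStep`), `SecondOrderPoint.A₃_origin₂_singular` (the origin of chart `2` IS a singular point of `G₂`),
  `SecondOrderPoint.A₃_exceptionalPoint_firstOrder` (that point is a node: (FO) for `(Φ', Ψ₁') = (T₀T₁ + T₂², 0)` by ✓ `FirstOrderPoint.firstOrder_node`)
  and `SecondOrderPoint.A₃_exceptionalPoint_oneStep` (its own one-step data (hone), from ✓ `FirstOrderPoint.exists_strictTransform`).

So, in polynomial currency, the `A₃` point has level EXACTLY `1`: one blow-up leaves one singular point over it, a node, which one more blow-up resolves.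
What this file does NOT do (remaining, scheme side, M–L): the bridge «(i)+(ii) for every chart ⟹ `D 1 H x`» through ✓ `towerLevel_succ_of_model` (points of
the glued chart model over the vertex ↔ primes `P ∋ T_l, G_l`; level `0` at the listed points by the T-ONESTEP bridge ✓ `isoHypPoint_of_oneStepPoints`).
Honest label: pure algebra; closes no registered stub of 20038 / 20148 / 15660.

References: [Hartshorne1977, I Thm. 5.1 (Jacobian criterion), I Ex. 5.8, II Ex. 7.12, V Ex. 5.? — resolution of `A_n` by point blow-ups is classical:
`A_k ↦ A_{k-2}`]; [Lipman1969, §24 (absolutely isolated double points)]; through the cited tree files.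
-/

set_option linter.dupNamespace false -- mandated namespace `Summit.<Summit>.<Problem>` of this single-conjunct summit

noncomputable section

open MvPolynomial

namespace Summit.ResolutionOfSingularities.ResolutionOfSingularities.Cruxes.EquisingularLiftNat.Sections

namespace SecondOrderPoint

variable (K : Type) [Field K] {n : ℕ}

/-! ## Graph charts: `G ≡ T_j (mod T_l)` is regular along `E = V(T_l)` -/

/-- **GRAPH CHARTS are regular along the exceptional divisor.**  If `G - T_j ∈ (T_l)` with `j ≠ l`, then `∂_jG ≡ 1 (mod T_l)`, so `∂_jG ∉ P` for
every prime `P ∋ T_l`. [cite: Hartshorne1977, I Thm. 5.1] -/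
theorem pderiv_not_mem_of_sub_X_mem_span {l j : Fin n} (hjl : j ≠ l) {G : MvPolynomial (Fin n) K}
    (hG : G - X j ∈ Ideal.span {(X l : MvPolynomial (Fin n) K)}) (P : Ideal (MvPolynomial (Fin n) K)) (hP : P.IsPrime)
    (hl : (X l : MvPolynomial (Fin n) K) ∈ P) : pderiv j G ∉ P := by
  obtain ⟨R, hR⟩ := Ideal.mem_span_singleton'.mp hG
  have hG' : G = X j + R * X l := by rw [hR]; ring
  intro h
  rw [hG', map_add, pderiv_X_self, pderiv_mul, pderiv_X_of_ne (Ne.symm hjl), mul_zero, add_zero] at h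
  have h1 : (1 : MvPolynomial (Fin n) K) = (1 + pderiv j R * X l) - pderiv j R * X l := by ring
  exact hP.ne_top ((Ideal.eq_top_iff_one P).mpr (h1 ▸ P.sub_mem h (P.mul_mem_left _ hl)))

/-! ## Product chart: `G ≡ T_a·T_b (mod T_l)` is singular on `E` at most where `T_a = T_b = 0` -/

/-- **PRODUCT CHART.**  If `G - T_a·T_b ∈ (T_l)` with `a, b, l` pairwise distinct, then `∂_aG ≡ T_b`, `∂_bG ≡ T_a (mod T_l)`; so an ideal containing
`T_l`, `∂_aG` and `∂_bG` contains `T_a` and `T_b`. [cite: Hartshorne1977, I Thm. 5.1] -/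
theorem X_mem_of_sub_mul_mem_span {a b l : Fin n} (hab : a ≠ b) (hal : a ≠ l) (hbl : b ≠ l) {G : MvPolynomial (Fin n) K}
    (hG : G - X a * X b ∈ Ideal.span {(X l : MvPolynomial (Fin n) K)}) (P : Ideal (MvPolynomial (Fin n) K))
    (hl : (X l : MvPolynomial (Fin n) K) ∈ P) (ha : pderiv a G ∈ P) (hb : pderiv b G ∈ P) :
    (X a : MvPolynomial (Fin n) K) ∈ P ∧ (X b : MvPolynomial (Fin n) K) ∈ P := by
  obtain ⟨R, hR⟩ := Ideal.mem_span_singleton'.mp hG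
  have hG' : G = X a * X b + R * X l := by rw [hR]; ring
  rw [hG', map_add, pderiv_mul, pderiv_X_self, pderiv_X_of_ne hab.symm, one_mul, mul_zero, add_zero, pderiv_mul,
    pderiv_X_of_ne (Ne.symm hal), mul_zero, add_zero] at ha
  rw [hG', map_add, pderiv_mul, pderiv_X_of_ne hab, pderiv_X_self, zero_mul, zero_add, mul_one, pderiv_mul,
    pderiv_X_of_ne (Ne.symm hbl), mul_zero, add_zero] at hb
  refine ⟨?_, ?_⟩
  · have h : (X a : MvPolynomial (Fin n) K) = (X a + pderiv b R * X l) - pderiv b R * X l := by ring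
    rw [h]; exact P.sub_mem hb (P.mul_mem_left _ hl)
  · have h : (X b : MvPolynomial (Fin n) K) = (X b + pderiv a R * X l) - pderiv a R * X l := by ring
    rw [h]; exact P.sub_mem ha (P.mul_mem_left _ hl)

/-- **PRODUCT CHART in `K[y₀, y₁, y₂]`**: if `G - T₀T₁ ∈ (T₂)` then an ideal containing `T₂`, `∂₀G`, `∂₁G` contains every variable — on the
exceptional divisor of chart `2` the strict transform is singular at most at the origin. [cite: Hartshorne1977, I Thm. 5.1] -/
theorem forall_X_mem_of_sub_mul_mem_span₃ {G : MvPolynomial (Fin 3) K}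
    (hG : G - X 0 * X 1 ∈ Ideal.span {(X 2 : MvPolynomial (Fin 3) K)}) (P : Ideal (MvPolynomial (Fin 3) K))
    (h2 : (X 2 : MvPolynomial (Fin 3) K) ∈ P) (h0 : pderiv 0 G ∈ P) (h1 : pderiv 1 G ∈ P) (i : Fin 3) :
    (X i : MvPolynomial (Fin 3) K) ∈ P := by
  obtain ⟨ha, hb⟩ := X_mem_of_sub_mul_mem_span K (a := 0) (b := 1) (l := 2) (by decide) (by decide) (by decide) hG P h2 h0 h1
  fin_cases i
  · exact ha
  · exact hb
  · exact h2

/-! ## Tangent cone `y₀y₁`: the three strict transforms of `f = y₀y₁ + Ψ`, `Ψ ∈ (y)³` -/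

/-- The chart-`l` substitution on the product `y_a y_b`, `a, b ≠ l`: `(T_lT_a)(T_lT_b) = T_l²·(T_aT_b)`. [folklore] -/
theorem aeval_subst_X_mul_X_of_ne (l a b : Fin n) (hal : a ≠ l) (hbl : b ≠ l) :
    aeval (fun j => X l * Function.update (X : Fin n → MvPolynomial (Fin n) K) l 1 j) (X a * X b : MvPolynomial (Fin n) K) =
      X l ^ 2 * (X a * X b) := by
  rw [map_mul, aeval_X, aeval_X, Function.update_of_ne hal, Function.update_of_ne hbl]
  ring

/-- The chart-`a` substitution on the product `y_a y_b`, `b ≠ a`: `T_a·(T_aT_b) = T_a²·T_b`. [folklore] -/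
theorem aeval_subst_X_mul_X_self_left (a b : Fin n) (hba : b ≠ a) :
    aeval (fun j => X a * Function.update (X : Fin n → MvPolynomial (Fin n) K) a 1 j) (X a * X b : MvPolynomial (Fin n) K) =
      X a ^ 2 * X b := by
  rw [map_mul, aeval_X, aeval_X, Function.update_self, Function.update_of_ne hba]
  ring

/-- ★ **Chart `0` of `f = y₀y₁ + Ψ`, `Ψ ∈ (y)³`**: `f(T₀, T₀T_j) = T₀²·G₀` with `G₀ = T₁ + T₀·R` — a GRAPH chart (`G₀ - T₁ ∈ (T₀)`).
[cite: Hartshorne1977, II Ex. 7.12] -/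
theorem strictTransform_A_chart₀ {Ψ : MvPolynomial (Fin 3) K}
    (hΨ : Ψ ∈ Ideal.span (Set.range (X : Fin 3 → MvPolynomial (Fin 3) K)) ^ 3) :
    ∃ G : MvPolynomial (Fin 3) K,
      aeval (fun j => X 0 * Function.update (X : Fin 3 → MvPolynomial (Fin 3) K) 0 1 j) (X 0 * X 1 + Ψ) = X 0 ^ 2 * G ∧
      G - X 1 ∈ Ideal.span {(X 0 : MvPolynomial (Fin 3) K)} := by
  obtain ⟨R, hR⟩ := FirstOrderPoint.exists_aeval_subst_eq_pow_mul K 0 hΨ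
  refine ⟨X 1 + X 0 * R, ?_, ?_⟩
  · rw [map_add, hR, aeval_subst_X_mul_X_self_left K 0 1 (by decide)]
    ring
  · exact Ideal.mem_span_singleton'.mpr ⟨R, by ring⟩

/-- ★ **Chart `1` of `f = y₀y₁ + Ψ`, `Ψ ∈ (y)³`**: `f(T₁T₀, T₁, T₁T₂) = T₁²·G₁` with `G₁ = T₀ + T₁·R` — a GRAPH chart (`G₁ - T₀ ∈ (T₁)`).
[cite: Hartshorne1977, II Ex. 7.12] -/
theorem strictTransform_A_chart₁ {Ψ : MvPolynomial (Fin 3) K}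
    (hΨ : Ψ ∈ Ideal.span (Set.range (X : Fin 3 → MvPolynomial (Fin 3) K)) ^ 3) :
    ∃ G : MvPolynomial (Fin 3) K,
      aeval (fun j => X 1 * Function.update (X : Fin 3 → MvPolynomial (Fin 3) K) 1 1 j) (X 0 * X 1 + Ψ) = X 1 ^ 2 * G ∧
      G - X 0 ∈ Ideal.span {(X 1 : MvPolynomial (Fin 3) K)} := by
  obtain ⟨R, hR⟩ := FirstOrderPoint.exists_aeval_subst_eq_pow_mul K 1 hΨ
  refine ⟨X 0 + X 1 * R, ?_, ?_⟩
  · rw [map_add, hR, show (X 0 * X 1 : MvPolynomial (Fin 3) K) = X 1 * X 0 from mul_comm _ _,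
      aeval_subst_X_mul_X_self_left K 1 0 (by decide)]
    ring
  · exact Ideal.mem_span_singleton'.mpr ⟨R, by ring⟩

/-- ★ **Chart `2` of `f = y₀y₁ + Ψ`, `Ψ ∈ (y)³`**: `f(T₂T₀, T₂T₁, T₂) = T₂²·G₂` with `G₂ = T₀T₁ + T₂·R` — a PRODUCT chart (`G₂ - T₀T₁ ∈ (T₂)`).
[cite: Hartshorne1977, II Ex. 7.12] -/
theorem strictTransform_A_chart₂ {Ψ : MvPolynomial (Fin 3) K}
    (hΨ : Ψ ∈ Ideal.span (Set.range (X : Fin 3 → MvPolynomial (Fin 3) K)) ^ 3) :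
    ∃ G : MvPolynomial (Fin 3) K,
      aeval (fun j => X 2 * Function.update (X : Fin 3 → MvPolynomial (Fin 3) K) 2 1 j) (X 0 * X 1 + Ψ) = X 2 ^ 2 * G ∧
      G - X 0 * X 1 ∈ Ideal.span {(X 2 : MvPolynomial (Fin 3) K)} := by
  obtain ⟨R, hR⟩ := FirstOrderPoint.exists_aeval_subst_eq_pow_mul K 2 hΨ
  refine ⟨X 0 * X 1 + X 2 * R, ?_, ?_⟩
  · rw [map_add, hR, aeval_subst_X_mul_X_of_ne K 2 0 1 (by decide) (by decide)]
    ring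
  · exact Ideal.mem_span_singleton'.mpr ⟨R, by ring⟩

/-- ★★ **`A`-TYPE SURFACE POINTS: after ONE blow-up the strict transform is regular along the exceptional divisor except possibly at ONE point.**
`f = y₀y₁ + Ψ`, `Ψ ∈ (y)³` (tangent cone two transversal planes), any field.  For each chart `l` there is a strict transform `G_l`
(`f(T_l, T_lT_j) = T_l²·G_l`) such that: in charts `0` and `1` the Jacobian test passes at EVERY prime `P ∋ T_l` (graph charts), and in chart `2` a prime
`P ∋ T₂` at which all `∂_jG₂` lie in `P` contains `T₀, T₁, T₂` — the origin of chart `2` is the only candidate singular point over the vertex.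
[cite: Hartshorne1977, I Thm. 5.1, II Ex. 7.12] -/
theorem A_charts_regular_off_origin₂ {Ψ : MvPolynomial (Fin 3) K}
    (hΨ : Ψ ∈ Ideal.span (Set.range (X : Fin 3 → MvPolynomial (Fin 3) K)) ^ 3) :
    (∃ G : MvPolynomial (Fin 3) K,
      aeval (fun j => X 0 * Function.update (X : Fin 3 → MvPolynomial (Fin 3) K) 0 1 j) (X 0 * X 1 + Ψ) = X 0 ^ 2 * G ∧
      ∀ P : Ideal (MvPolynomial (Fin 3) K), P.IsPrime → (X 0 : MvPolynomial (Fin 3) K) ∈ P → ∃ j, pderiv j G ∉ P) ∧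
    (∃ G : MvPolynomial (Fin 3) K,
      aeval (fun j => X 1 * Function.update (X : Fin 3 → MvPolynomial (Fin 3) K) 1 1 j) (X 0 * X 1 + Ψ) = X 1 ^ 2 * G ∧
      ∀ P : Ideal (MvPolynomial (Fin 3) K), P.IsPrime → (X 1 : MvPolynomial (Fin 3) K) ∈ P → ∃ j, pderiv j G ∉ P) ∧
    (∃ G : MvPolynomial (Fin 3) K,
      aeval (fun j => X 2 * Function.update (X : Fin 3 → MvPolynomial (Fin 3) K) 2 1 j) (X 0 * X 1 + Ψ) = X 2 ^ 2 * G ∧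
      ∀ P : Ideal (MvPolynomial (Fin 3) K), P.IsPrime → (X 2 : MvPolynomial (Fin 3) K) ∈ P → (∀ j, pderiv j G ∈ P) →
        ∀ i, (X i : MvPolynomial (Fin 3) K) ∈ P) := by
  refine ⟨?_, ?_, ?_⟩
  · obtain ⟨G, hG, hG'⟩ := strictTransform_A_chart₀ K hΨ
    exact ⟨G, hG, fun P hP h0 => ⟨1, pderiv_not_mem_of_sub_X_mem_span K (by decide) hG' P hP h0⟩⟩
  · obtain ⟨G, hG, hG'⟩ := strictTransform_A_chart₁ K hΨ
    exact ⟨G, hG, fun P hP h1 => ⟨0, pderiv_not_mem_of_sub_X_mem_span K (by decide) hG' P hP h1⟩⟩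
  · obtain ⟨G, hG, hG'⟩ := strictTransform_A_chart₂ K hΨ
    exact ⟨G, hG, fun P _ h2 hd i => forall_X_mem_of_sub_mul_mem_span₃ K hG' P h2 (hd 0) (hd 1) i⟩

/-! ## ★★ The `A₃` specimen `f = y₀y₁ + y₂⁴`: level exactly `1` -/

/-- `y₂⁴ ∈ (y)³` (indeed `∈ (y)⁴`): the specimen has the shape `y₀y₁ + Ψ` of the `A`-type lemmas. [folklore] -/
theorem A₃_tail_mem_pow : (X 2 ^ 4 : MvPolynomial (Fin 3) K) ∈ Ideal.span (Set.range (X : Fin 3 → MvPolynomial (Fin 3) K)) ^ 3 := by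
  have h2 : (X 2 : MvPolynomial (Fin 3) K) ∈ Ideal.span (Set.range (X : Fin 3 → MvPolynomial (Fin 3) K)) :=
    Ideal.subset_span ⟨2, rfl⟩
  have h3 : (X 2 ^ 3 : MvPolynomial (Fin 3) K) ∈ Ideal.span (Set.range (X : Fin 3 → MvPolynomial (Fin 3) K)) ^ 3 :=
    Ideal.pow_mem_pow h2 3
  have h : (X 2 ^ 4 : MvPolynomial (Fin 3) K) = X 2 * X 2 ^ 3 := by ring
  rw [h]
  exact Ideal.mul_mem_left _ _ h3

/-- ★ **The `A₃` specimen is NOT a first-order point**: with `Φ = y₀y₁` (`μ = 2`) and `Ψ₁ = 0` (no cubic term) the vector `b = e₂ ≠ 0` is a common zero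
of `Φ`, `∇Φ = (y₁, y₀, 0)` and `Ψ₁`, so the closed-point form of (FO) fails — by ✓ `FirstOrderPoint.firstOrder_iff_oneStep` the point is not resolved by
one blow-up. [folklore] -/
theorem A₃_not_firstOrder :
    ¬ (∀ b : Fin 3 → K, aeval b (X 0 * X 1 : MvPolynomial (Fin 3) K) = 0 →
        (∀ i, aeval b (pderiv i (X 0 * X 1 : MvPolynomial (Fin 3) K)) = 0) → aeval b (0 : MvPolynomial (Fin 3) K) = 0 → b = 0) := by
  intro h
  have hb := h (Pi.single 2 1) (by simp) (fun i => by
    rw [pderiv_mul, map_add, map_mul, map_mul, aeval_X, aeval_X]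
    simp) (by simp)
  have h1 : (Pi.single 2 1 : Fin 3 → K) 2 = 0 := by rw [hb]; rfl
  simp at h1

/-- ★ **The `A₃` specimen, chart `2` ON THE NOSE**: `f(T₂T₀, T₂T₁, T₂) = T₂²·(T₀T₁ + T₂²)`. [cite: Hartshorne1977, II Ex. 7.12] -/
theorem A₃_strictTransform₂ :
    aeval (fun j => X 2 * Function.update (X : Fin 3 → MvPolynomial (Fin 3) K) 2 1 j) (X 0 * X 1 + X 2 ^ 4 : MvPolynomial (Fin 3) K) =
      X 2 ^ 2 * (X 0 * X 1 + X 2 ^ 2) := by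
  rw [map_add, aeval_subst_X_mul_X_of_ne K 2 0 1 (by decide) (by decide), map_pow, aeval_X, Function.update_self]
  ring

/-- ★ **The `A₃` specimen, charts `0` and `1` ON THE NOSE**: `f(T₀, T₀T₁, T₀T₂) = T₀²·(T₁ + T₀²T₂⁴)` and `f(T₁T₀, T₁, T₁T₂) = T₁²·(T₀ + T₁²T₂⁴)` —
graph charts, regular everywhere (`∂₁`, resp. `∂₀`, of the strict transform is `1`). [cite: Hartshorne1977, II Ex. 7.12] -/
theorem A₃_strictTransform₀₁ :
    aeval (fun j => X 0 * Function.update (X : Fin 3 → MvPolynomial (Fin 3) K) 0 1 j) (X 0 * X 1 + X 2 ^ 4 : MvPolynomial (Fin 3) K) =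
      X 0 ^ 2 * (X 1 + X 0 ^ 2 * X 2 ^ 4) ∧
    aeval (fun j => X 1 * Function.update (X : Fin 3 → MvPolynomial (Fin 3) K) 1 1 j) (X 0 * X 1 + X 2 ^ 4 : MvPolynomial (Fin 3) K) =
      X 1 ^ 2 * (X 0 + X 1 ^ 2 * X 2 ^ 4) ∧
    pderiv 1 (X 1 + X 0 ^ 2 * X 2 ^ 4 : MvPolynomial (Fin 3) K) = 1 ∧ pderiv 0 (X 0 + X 1 ^ 2 * X 2 ^ 4 : MvPolynomial (Fin 3) K) = 1 := by
  refine ⟨?_, ?_, ?_, ?_⟩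
  · rw [map_add, aeval_subst_X_mul_X_self_left K 0 1 (by decide), map_pow, aeval_X, Function.update_of_ne (by decide : (2 : Fin 3) ≠ 0)]
    ring
  · rw [map_add, show (X 0 * X 1 : MvPolynomial (Fin 3) K) = X 1 * X 0 from mul_comm _ _, aeval_subst_X_mul_X_self_left K 1 0 (by decide),
      map_pow, aeval_X, Function.update_of_ne (by decide : (2 : Fin 3) ≠ 1)]
    ring
  · rw [map_add, pderiv_X_self, pderiv_mul, pderiv_pow, pderiv_X_of_ne (by decide : (0 : Fin 3) ≠ 1), pderiv_pow,
      pderiv_X_of_ne (by decide : (2 : Fin 3) ≠ 1)]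
    ring
  · rw [map_add, pderiv_X_self, pderiv_mul, pderiv_pow, pderiv_X_of_ne (by decide : (1 : Fin 3) ≠ 0), pderiv_pow,
      pderiv_X_of_ne (by decide : (2 : Fin 3) ≠ 0)]
    ring

/-- ★ **The origin of chart `2` IS a singular point of `G₂ = T₀T₁ + T₂²`** (so the specimen's level is not `0` on the nose either): `G₂` and all its
partials `T₁, T₀, 2T₂` lie in the maximal ideal `(T₀, T₁, T₂)` = the kernel of evaluation at `0`. [cite: Hartshorne1977, I Thm. 5.1] -/
theorem A₃_origin₂_singular :
    (X 0 * X 1 + X 2 ^ 2 : MvPolynomial (Fin 3) K) ∈ RingHom.ker (eval (0 : Fin 3 → K)) ∧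
      ∀ i, pderiv i (X 0 * X 1 + X 2 ^ 2 : MvPolynomial (Fin 3) K) ∈ RingHom.ker (eval (0 : Fin 3 → K)) := by
  refine ⟨by simp [RingHom.mem_ker], fun i => ?_⟩
  rw [RingHom.mem_ker, map_add, pderiv_mul, pderiv_pow]
  simp

/-- ★★ **The exceptional singular point of the `A₃` specimen is FIRST-ORDER (a node, every characteristic)**: for `G₂ = T₀T₁ + T₂²` at the origin the
tangent cone is `Φ' = T₀T₁ + T₂²` itself and `Ψ₁' = 0`; (FO) holds by ✓ `FirstOrderPoint.firstOrder_node`. [cite: Hartshorne1977, I Thm. 5.1] -/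
theorem A₃_exceptionalPoint_firstOrder (P : Ideal (MvPolynomial (Fin 3) K)) (hP : P.IsPrime)
    (hΦ : (X 0 * X 1 + X 2 ^ 2 : MvPolynomial (Fin 3) K) ∈ P) (hd : ∀ i, pderiv i (X 0 * X 1 + X 2 ^ 2 : MvPolynomial (Fin 3) K) ∈ P)
    (hΨ : (0 : MvPolynomial (Fin 3) K) ∈ P) (i : Fin 3) : (X i : MvPolynomial (Fin 3) K) ∈ P :=
  FirstOrderPoint.firstOrder_node K 0 P hP hΦ hd hΨ i

/-- ★★ **LEVEL-1 CERTIFICATE, polynomial half, for the `A₃` specimen**: the exceptional singular point `G₂ = T₀T₁ + T₂²` (`= Φ' + (Ψ₁' + Ψ'')` with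
`Φ' = G₂` a form of degree `2`, `Ψ₁' = 0`, `Ψ'' = 0`) is a ONE-STEP point — for every chart direction `l` an explicit strict transform with the
total-transform identity and the Jacobian certificate at every prime of its exceptional divisor (✓ `FirstOrderPoint.exists_strictTransform`).
[cite: Hartshorne1977, I Thm. 5.1, II Ex. 7.12] -/
theorem A₃_exceptionalPoint_oneStep (l : Fin 3) :
    ∃ G : MvPolynomial (Fin 3) K,
      aeval (fun j => X l * Function.update (X : Fin 3 → MvPolynomial (Fin 3) K) l 1 j)
          ((X 0 * X 1 + X 2 ^ 2 : MvPolynomial (Fin 3) K) + (0 + 0)) = X l ^ 2 * G ∧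
      ∀ P : Ideal (MvPolynomial (Fin 3) K), P.IsPrime → (X l : MvPolynomial (Fin 3) K) ∈ P → G ∈ P → ∃ j, pderiv j G ∉ P := by
  have hΦ : (X 0 * X 1 + X 2 ^ 2 : MvPolynomial (Fin 3) K).IsHomogeneous 2 := by
    refine IsHomogeneous.add ?_ (isHomogeneous_X_pow 2 2)
    simpa using (isHomogeneous_X K (0 : Fin 3)).mul (isHomogeneous_X K (1 : Fin 3))
  exact FirstOrderPoint.exists_strictTransform K (X 0 * X 1 + X 2 ^ 2) 0 0 hΦ (isHomogeneous_zero _ _ _) (Ideal.zero_mem _)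
    (fun P hP hΦP hdP hΨP => A₃_exceptionalPoint_firstOrder K P hP hΦP hdP hΨP) l

end SecondOrderPoint

end Summit.ResolutionOfSingularities.ResolutionOfSingularities.Cruxes.EquisingularLiftNat.Sections

end
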